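import Summits.CriticalPhenomena.PercolationContinuityZ3.Theorems.PercNearOneGluingNoHeavyLowerTailSahiCombTriWAndOneBlock

/-!
# AND-products pass every RECTANGLE test with good sides: `Cor_{P₁ ∧ Q}(A₁ × A₂, B) ≥ 0` whenever `Cor_{A₁} ≥ 0` and `Cor_{A₂} ≥ 0`

Support file of the one-cut programme (crux `NoHeavyLowerTail`, stmt-CriticalPhenomena-4575; unit `prim-lf-1` gen 60, memo
`FROM-prim-lf-1-gen60-ONE-BLOCK.md` §1–§3).  Continuation of `…SahiCombTriWAndOneBlock` (every ONE-BLOCK test `A = A₁ × 2^{γ₂}` passes on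
`P₁ ∧ Q` for every good `P₁` and every up-set `Q`).  Here the test set is a genuine TWO-BLOCK set, a RECTANGLE `A = andProd A₁ A₂ = A₁ × A₂`:

* **`corP_andProd_rect_nonneg`**: let `P₁ ⊆ 2^{γ₁}` and `Q ⊆ 2^{γ₂}` be antipode-free up-sets with `Cor ≥ 0` on all pairs of up-sets (intersecting
  Kleitman shells), `A₁ ⊆ 2^{γ₁}`, `A₂ ⊆ 2^{γ₂}` up-sets with `Cor_{A₁} ≥ 0`, `Cor_{A₂} ≥ 0` on all pairs of up-sets (e.g. the whole cube, principal
  families, self-dual families, `maj`, every certified block — NOT required to be antipode free), and `B` ANY up-set of the product cube.  Then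
  `0 ≤ corP (andProd P₁ Q) (andProd A₁ A₂) B`  (`…_right`: rectangle in the second slot; `…_of_klShell`: shell hypotheses).
  With `A₂ = univ` (`Cor_univ ≥ 0` is Kleitman's lemma, `corP_univ_nonneg`) this contains the one-block theorem.

Proof.  On `P₁ × Q` the `δ`-vector of the rectangle factorises, `δ_A(x⊔y) = a(x)b(y) − ā(x)b̄(y)` with `a = [· ∈ A₁]`, `ā = [·ᶜ ∈ A₁]`,
`b, b̄` likewise (`sgnDiff_rect`), and `2(ab − āb̄) = (a−ā)(b+b̄) + (a+ā)(b−b̄)`.  Hence (`two_mul_corP_andProd_rect_eq`)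
`2·Cor = Σ_{x∈P₁} δ_{A₁}(x)·β(x) + Σ_{y∈Q} δ_{A₂}(y)·α(y)` with the WEIGHTED ROW SUM `β(x) = Σ_{y∈Q} ([y∈A₂]+[yᶜ∈A₂])·δ_B(x⊔y)` and the
weighted column sum `α`.  The key lemma `sum_wInd_mul_sgnDiff_eq_corP`: for every `z`,
`Σ_{y∈Q} ([y∈A₂]+[yᶜ∈A₂])·([z⊔y∈B] − [z⊔yᶜ∈B]) = Cor_{A₂}(Q, B_z)` (`B_z = secR B z` the right section), so `Cor_{A₂} ≥ 0` makes `β` an integer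
`K`-vector on `P₁` (`wRowSum_pair`; monotone, `|β| ≤ 2·#Q`) exactly as Kleitman's lemma did for the unweighted row sum of the one-block file; then
`Σ δ_{A₁} β ≥ 0` by acuteness of `P₁` (`sum_mul_nonneg_of_unit_of_bounded`).  The column half is the row half of the block-swapped data
(`sgnDiff_famMap_sumComm`, `…TriWAndComm`).
HONEST LABEL: complete proofs, std axioms; a second unconditional two-factor stratum of (II)/`AndShellLower` (rectangles with good sides, all
sizes); rectangles with a bad side (e.g. `A₂ = y₁ ∨ y₂`) and non-rectangular two-block tests stay OPEN — the cone `K(P₁)⊗Mon₊ + Mon₊⊗K(Q)` of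
one-block-certified test functions misses most product configurations (memo §3, kit j249903). [this work]
-/

namespace Summit.CriticalPhenomena.PercolationContinuityZ3.Theorems

namespace FiveUpSet

open Finset

variable {γ₁ γ₂ : Type} [DecidableEq γ₁] [Fintype γ₁] [DecidableEq γ₂] [Fintype γ₂]

/-! ### Indicator bookkeeping -/

/-- Reindexing a sum over the cube by complementation. [this work] -/
theorem sum_univ_compl_eq (f : Finset γ₂ → ℤ) : ∑ y : Finset γ₂, f yᶜ = ∑ y : Finset γ₂, f y :=
  Equiv.sum_comp (complEquiv γ₂) f

/-- **The weighted row identity.**  For any families `X, Q, S` of the block: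
`Σ_{y∈Q} ([y∈X] + [yᶜ∈X])·δ_S(y) = Cor_X(Q, S)`  (`δ_S = [·∈S] − [·ᶜ∈S]`). [this work] -/
theorem sum_wInd_mul_sgnDiff_eq_corP (X Q S : Finset (Finset γ₂)) :
    ∑ y ∈ Q, (ind X y + ind X yᶜ) * sgnDiff S (refl S) y = corP X Q S := by
  rw [corP_eq_sum, sum_mem_eq_sum_ind, sum_mem_eq_sum_ind X]
  -- both sides are sums over the cube; the cross terms cancel after `y ↦ yᶜ`
  have hodd : ∀ y : Finset γ₂, sgnDiff S (refl S) yᶜ = -sgnDiff S (refl S) y := by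
    intro y; rw [sgnDiff_refl_eq, sgnDiff_refl_eq, compl_compl]; ring
  have hcross : ∑ y : Finset γ₂, ind Q y * ind X yᶜ * sgnDiff S (refl S) y
      = -∑ y : Finset γ₂, ind Q yᶜ * ind X y * sgnDiff S (refl S) y := by
    rw [← sum_univ_compl_eq (fun y => ind Q y * ind X yᶜ * sgnDiff S (refl S) y), ← sum_neg_distrib]
    refine sum_congr rfl fun y _ => ?_
    simp only [compl_compl, hodd]; ring
  have h1 : ∑ y : Finset γ₂, ind Q y * ((ind X y + ind X yᶜ) * sgnDiff S (refl S) y)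
      = ∑ y : Finset γ₂, ind Q y * ind X y * sgnDiff S (refl S) y + ∑ y : Finset γ₂, ind Q y * ind X yᶜ * sgnDiff S (refl S) y := by
    rw [← sum_add_distrib]; exact sum_congr rfl fun y _ => by ring
  have h2 : ∑ y : Finset γ₂, ind X y * (sgnDiff Q (refl Q) y * sgnDiff S (refl S) y)
      = ∑ y : Finset γ₂, ind Q y * ind X y * sgnDiff S (refl S) y - ∑ y : Finset γ₂, ind Q yᶜ * ind X y * sgnDiff S (refl S) y := by
    rw [← sum_sub_distrib]; exact sum_congr rfl fun y _ => by rw [sgnDiff_refl_eq Q]; ring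
  rw [h1, h2, hcross]; ring

omit [Fintype γ₁] in
/-- The row of `δ_B` at `z` read through the right section: `[z⊔y ∈ B] − [z⊔yᶜ ∈ B] = δ_{secR B z}(y)`. [this work] -/
theorem ind_disjSum_sub_eq_sgnDiff_secR (B : Finset (Finset (γ₁ ⊕ γ₂))) (z : Finset γ₁) (y : Finset γ₂) :
    ind B (z.disjSum y) - ind B (z.disjSum yᶜ) = sgnDiff (secR B z) (refl (secR B z)) y := by
  rw [sgnDiff_refl_eq]; unfold ind; simp only [mem_secR]

/-! ### The weighted row sum `β(x) = Σ_{y∈Q} ([y∈A₂]+[yᶜ∈A₂])·δ_B(x⊔y)` -/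

omit [Fintype γ₁] in
/-- **Key step**: for every `z`, `Σ_{y∈Q} ([y∈A₂]+[yᶜ∈A₂])·([z⊔y∈B] − [z⊔yᶜ∈B]) = Cor_{A₂}(Q, secR B z)`; hence it is `≥ 0` as soon as
`Cor_{A₂} ≥ 0` on pairs of up-sets and `Q, B` are up-sets. [this work] -/
theorem sum_wInd_row_nonneg {A₂ : Finset (Finset γ₂)}
    (hcor₂ : ∀ U V : Finset (Finset γ₂), IsUpperSet (U : Set (Finset γ₂)) → IsUpperSet (V : Set (Finset γ₂)) → 0 ≤ corP A₂ U V)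
    {Q : Finset (Finset γ₂)} (hQ : IsUpperSet (Q : Set (Finset γ₂)))
    {B : Finset (Finset (γ₁ ⊕ γ₂))} (hB : IsUpperSet (B : Set (Finset (γ₁ ⊕ γ₂)))) (z : Finset γ₁) :
    0 ≤ ∑ y ∈ Q, (ind A₂ y + ind A₂ yᶜ) * (ind B (z.disjSum y) - ind B (z.disjSum yᶜ)) := by
  rw [sum_congr rfl fun y _ => by rw [ind_disjSum_sub_eq_sgnDiff_secR], sum_wInd_mul_sgnDiff_eq_corP]
  exact hcor₂ Q (secR B z) hQ (isUpperSet_secR hB z)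

/-- The weighted row sum as a sum of indicator expressions. [this work] -/
theorem wRowSum_eq (A₂ : Finset (Finset γ₂)) (B : Finset (Finset (γ₁ ⊕ γ₂))) (Q : Finset (Finset γ₂)) (x : Finset γ₁) :
    ∑ y ∈ Q, (ind A₂ y + ind A₂ yᶜ) * sgnDiff B (refl B) (x.disjSum y)
      = ∑ y ∈ Q, (ind A₂ y + ind A₂ yᶜ) * (ind B (x.disjSum y) - ind B (xᶜ.disjSum yᶜ)) :=
  sum_congr rfl fun y _ => by rw [sgnDiff_refl_eq, compl_disjSum]

/-- The weight `[y∈A₂]+[yᶜ∈A₂]` lies in `[0,2]`. [this work] -/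
theorem wInd_bounds (A₂ : Finset (Finset γ₂)) (y : Finset γ₂) : 0 ≤ ind A₂ y + ind A₂ yᶜ ∧ ind A₂ y + ind A₂ yᶜ ≤ 2 := by
  have h1 := ind_nonneg_le_one A₂ y; have h2 := ind_nonneg_le_one A₂ yᶜ; constructor <;> linarith

/-- The weighted row sum is increasing in `x`. [this work] -/
theorem wRowSum_mono (A₂ : Finset (Finset γ₂)) {B : Finset (Finset (γ₁ ⊕ γ₂))} (hB : IsUpperSet (B : Set (Finset (γ₁ ⊕ γ₂))))
    (Q : Finset (Finset γ₂)) {x x' : Finset γ₁} (h : x ⊆ x') :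
    ∑ y ∈ Q, (ind A₂ y + ind A₂ yᶜ) * sgnDiff B (refl B) (x.disjSum y) ≤ ∑ y ∈ Q, (ind A₂ y + ind A₂ yᶜ) * sgnDiff B (refl B) (x'.disjSum y) := by
  rw [wRowSum_eq, wRowSum_eq]
  refine sum_le_sum fun y _ => ?_
  have h1 := ind_mono_pt hB (disjSum_mono h (le_refl y))
  have h2 := ind_mono_pt hB (disjSum_mono (compl_subset_compl.2 h) (le_refl yᶜ))
  exact mul_le_mul_of_nonneg_left (by linarith) (wInd_bounds A₂ y).1

/-- The weighted row sum has values in `[-2·#Q, 2·#Q]`. [this work] -/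
theorem wRowSum_bounds (A₂ : Finset (Finset γ₂)) (B : Finset (Finset (γ₁ ⊕ γ₂))) (Q : Finset (Finset γ₂)) (x : Finset γ₁) :
    -((2 * Q.card : ℕ) : ℤ) ≤ ∑ y ∈ Q, (ind A₂ y + ind A₂ yᶜ) * sgnDiff B (refl B) (x.disjSum y) ∧
      ∑ y ∈ Q, (ind A₂ y + ind A₂ yᶜ) * sgnDiff B (refl B) (x.disjSum y) ≤ ((2 * Q.card : ℕ) : ℤ) := by
  rw [wRowSum_eq]
  have hterm : ∀ y ∈ Q, -2 ≤ (ind A₂ y + ind A₂ yᶜ) * (ind B (x.disjSum y) - ind B (xᶜ.disjSum yᶜ)) ∧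
      (ind A₂ y + ind A₂ yᶜ) * (ind B (x.disjSum y) - ind B (xᶜ.disjSum yᶜ)) ≤ 2 := by
    intro y _
    have hw := wInd_bounds A₂ y
    have h1 := ind_nonneg_le_one B (x.disjSum y); have h2 := ind_nonneg_le_one B (xᶜ.disjSum yᶜ)
    constructor <;> nlinarith
  push_cast
  constructor
  · have h : ∑ y ∈ Q, (-2 : ℤ) ≤ ∑ y ∈ Q, (ind A₂ y + ind A₂ yᶜ) * (ind B (x.disjSum y) - ind B (xᶜ.disjSum yᶜ)) :=
      sum_le_sum fun y hy => (hterm y hy).1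
    rw [sum_const, smul_neg] at h
    simp only [nsmul_eq_mul] at h
    linarith
  · have h : ∑ y ∈ Q, (ind A₂ y + ind A₂ yᶜ) * (ind B (x.disjSum y) - ind B (xᶜ.disjSum yᶜ)) ≤ ∑ y ∈ Q, (2 : ℤ) :=
      sum_le_sum fun y hy => (hterm y hy).2
    rw [sum_const] at h
    simp only [nsmul_eq_mul] at h
    linarith

/-- **The pair condition for the weighted row sum**: if `Cor_{A₂} ≥ 0` on pairs of up-sets and `Q, B` are up-sets, then
`x ∪ x' = ⊤ ⟹ β(x) + β(x') ≥ 0`.  After the two monotonicity steps `x'ᶜ ⊆ x`, `xᶜ ⊆ x'` it is the sum of `Cor_{A₂}(Q, secR B x'ᶜ) ≥ 0` and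
`Cor_{A₂}(Q, secR B xᶜ) ≥ 0`. [this work] -/
theorem wRowSum_pair {A₂ : Finset (Finset γ₂)}
    (hcor₂ : ∀ U V : Finset (Finset γ₂), IsUpperSet (U : Set (Finset γ₂)) → IsUpperSet (V : Set (Finset γ₂)) → 0 ≤ corP A₂ U V)
    {Q : Finset (Finset γ₂)} (hQ : IsUpperSet (Q : Set (Finset γ₂)))
    {B : Finset (Finset (γ₁ ⊕ γ₂))} (hB : IsUpperSet (B : Set (Finset (γ₁ ⊕ γ₂)))) {x x' : Finset γ₁} (h : x ∪ x' = univ) :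
    0 ≤ ∑ y ∈ Q, (ind A₂ y + ind A₂ yᶜ) * sgnDiff B (refl B) (x.disjSum y) +
        ∑ y ∈ Q, (ind A₂ y + ind A₂ yᶜ) * sgnDiff B (refl B) (x'.disjSum y) := by
  have hc : xᶜ ⊆ x' := by
    intro a ha; rw [mem_compl] at ha
    have := mem_univ a; rw [← h, mem_union] at this; tauto
  have hc' : x'ᶜ ⊆ x := by
    intro a ha; rw [mem_compl] at ha
    have := mem_univ a; rw [← h, mem_union] at this; tauto
  rw [wRowSum_eq, wRowSum_eq, ← sum_add_distrib]
  have key : ∀ y ∈ Q,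
      (ind A₂ y + ind A₂ yᶜ) * (ind B (x'ᶜ.disjSum y) - ind B (x'ᶜ.disjSum yᶜ)) +
        (ind A₂ y + ind A₂ yᶜ) * (ind B (xᶜ.disjSum y) - ind B (xᶜ.disjSum yᶜ))
      ≤ (ind A₂ y + ind A₂ yᶜ) * (ind B (x.disjSum y) - ind B (xᶜ.disjSum yᶜ)) +
        (ind A₂ y + ind A₂ yᶜ) * (ind B (x'.disjSum y) - ind B (x'ᶜ.disjSum yᶜ)) := by
    intro y _
    have h1 := ind_mono_pt hB (disjSum_mono hc' (le_refl y))
    have h2 := ind_mono_pt hB (disjSum_mono hc (le_refl y))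
    have hw := wInd_bounds A₂ y
    nlinarith
  have hle := sum_le_sum key
  rw [sum_add_distrib] at hle
  have k1 := sum_wInd_row_nonneg hcor₂ hQ hB x'ᶜ
  have k2 := sum_wInd_row_nonneg hcor₂ hQ hB xᶜ
  linarith

/-- **The row half**: `0 ≤ Σ_{x∈P₁} δ_{A₁}(x)·β(x)` for an antipode-free up-set `P₁` with `Cor_{P₁} ≥ 0`, an up-set `A₁`, and `A₂, Q, B` as in
`wRowSum_pair` (acuteness of `P₁` against the integer `K`-vector `β`). [this work] -/
theorem rectRow_nonneg {P₁ : Finset (Finset γ₁)} (hP : IsUpperSet (P₁ : Set (Finset γ₁))) (hd : Disjoint P₁ (refl P₁))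
    (hcor : ∀ U V : Finset (Finset γ₁), IsUpperSet (U : Set (Finset γ₁)) → IsUpperSet (V : Set (Finset γ₁)) → 0 ≤ corP P₁ U V)
    {A₁ : Finset (Finset γ₁)} (hA₁ : IsUpperSet (A₁ : Set (Finset γ₁)))
    {A₂ : Finset (Finset γ₂)}
    (hcor₂ : ∀ U V : Finset (Finset γ₂), IsUpperSet (U : Set (Finset γ₂)) → IsUpperSet (V : Set (Finset γ₂)) → 0 ≤ corP A₂ U V)
    {Q : Finset (Finset γ₂)} (hQ : IsUpperSet (Q : Set (Finset γ₂)))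
    {B : Finset (Finset (γ₁ ⊕ γ₂))} (hB : IsUpperSet (B : Set (Finset (γ₁ ⊕ γ₂)))) :
    0 ≤ ∑ x ∈ P₁, sgnDiff A₁ (refl A₁) x * ∑ y ∈ Q, (ind A₂ y + ind A₂ yᶜ) * sgnDiff B (refl B) (x.disjSum y) :=
  sum_mul_nonneg_of_unit_of_bounded hP hd hcor (sgnDiff A₁ (refl A₁)) (fun x _ => sgnDiff_refl_val A₁ x)
    (fun _ _ _ _ h => sgnDiff_refl_mono hA₁ h) (fun _ _ _ _ h => sgnDiff_refl_pair hA₁ h)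
    (2 * Q.card) (fun x => ∑ y ∈ Q, (ind A₂ y + ind A₂ yᶜ) * sgnDiff B (refl B) (x.disjSum y))
    (fun x _ => wRowSum_bounds A₂ B Q x) (fun _ _ _ _ h => wRowSum_mono A₂ hB Q h) (fun _ _ _ _ h => wRowSum_pair hcor₂ hQ hB h)

/-! ### The rectangle: factorisation of its `δ`-vector and the decomposition of `Cor` -/

/-- The `δ`-vector of a rectangle factorises on the product cube: `δ_{A₁×A₂}(x⊔y) = [x∈A₁][y∈A₂] − [xᶜ∈A₁][yᶜ∈A₂]`. [this work] -/
theorem sgnDiff_rect (A₁ : Finset (Finset γ₁)) (A₂ : Finset (Finset γ₂)) (x : Finset γ₁) (y : Finset γ₂) :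
    sgnDiff (andProd A₁ A₂) (refl (andProd A₁ A₂)) (x.disjSum y) = ind A₁ x * ind A₂ y - ind A₁ xᶜ * ind A₂ yᶜ := by
  rw [sgnDiff_refl_eq, compl_disjSum]
  unfold ind
  simp only [mem_andProd, toLeft_disjSum, toRight_disjSum]
  by_cases h1 : x ∈ A₁ <;> by_cases h2 : y ∈ A₂ <;> by_cases h3 : xᶜ ∈ A₁ <;> by_cases h4 : yᶜ ∈ A₂ <;> simp [h1, h2, h3, h4]

/-- **Decomposition of `Cor` against a rectangle into a row half and a column half**:
`2·Cor_{P₁∧Q}(A₁×A₂, B) = Σ_{x∈P₁} δ_{A₁}(x)·Σ_{y∈Q}([y∈A₂]+[yᶜ∈A₂])δ_B(x⊔y) + Σ_{y∈Q} δ_{A₂}(y)·Σ_{x∈P₁}([x∈A₁]+[xᶜ∈A₁])δ_B(x⊔y)`.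
[this work] -/
theorem two_mul_corP_andProd_rect_eq (P₁ : Finset (Finset γ₁)) (Q : Finset (Finset γ₂)) (A₁ : Finset (Finset γ₁)) (A₂ : Finset (Finset γ₂))
    (B : Finset (Finset (γ₁ ⊕ γ₂))) :
    2 * corP (andProd P₁ Q) (andProd A₁ A₂) B
      = ∑ x ∈ P₁, sgnDiff A₁ (refl A₁) x * ∑ y ∈ Q, (ind A₂ y + ind A₂ yᶜ) * sgnDiff B (refl B) (x.disjSum y)
        + ∑ y ∈ Q, sgnDiff A₂ (refl A₂) y * ∑ x ∈ P₁, (ind A₁ x + ind A₁ xᶜ) * sgnDiff B (refl B) (x.disjSum y) := by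
  rw [corP_andProd_eq_sum_sum, mul_sum]
  have hrow : ∀ x ∈ P₁, 2 * ∑ y ∈ Q, sgnDiff (andProd A₁ A₂) (refl (andProd A₁ A₂)) (x.disjSum y) * sgnDiff B (refl B) (x.disjSum y)
      = sgnDiff A₁ (refl A₁) x * ∑ y ∈ Q, (ind A₂ y + ind A₂ yᶜ) * sgnDiff B (refl B) (x.disjSum y)
        + ∑ y ∈ Q, sgnDiff A₂ (refl A₂) y * ((ind A₁ x + ind A₁ xᶜ) * sgnDiff B (refl B) (x.disjSum y)) := by
    intro x _
    rw [mul_sum, mul_sum, ← sum_add_distrib]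
    refine sum_congr rfl fun y _ => ?_
    rw [sgnDiff_rect, sgnDiff_refl_eq A₁, sgnDiff_refl_eq A₂]
    ring
  rw [sum_congr rfl hrow, sum_add_distrib, sum_comm]
  congr 1
  refine sum_congr rfl fun y _ => ?_
  rw [mul_sum]

/-! ### The block swap for the column half -/

omit [DecidableEq γ₁] [Fintype γ₁] [DecidableEq γ₂] [Fintype γ₂] in
/-- Swapping the blocks of a point of the product cube. [this work] -/
theorem map_sumComm_disjSum (y : Finset γ₂) (x : Finset γ₁) :
    (y.disjSum x).map (Equiv.sumComm γ₂ γ₁).toEmbedding = x.disjSum y := by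
  symm
  rw [disjSum_eq_iff, toLeft_map_sumComm, toRight_map_sumComm, toRight_disjSum, toLeft_disjSum]
  exact ⟨rfl, rfl⟩

/-- The `δ`-vector of the block-swapped family at the swapped point. [this work] -/
theorem sgnDiff_famMap_sumComm (B : Finset (Finset (γ₁ ⊕ γ₂))) (x : Finset γ₁) (y : Finset γ₂) :
    sgnDiff (famMap (Equiv.sumComm γ₁ γ₂) B) (refl (famMap (Equiv.sumComm γ₁ γ₂) B)) (y.disjSum x) = sgnDiff B (refl B) (x.disjSum y) := by
  have key : ∀ C : Finset (Finset (γ₁ ⊕ γ₂)), y.disjSum x ∈ famMap (Equiv.sumComm γ₁ γ₂) C ↔ x.disjSum y ∈ C := fun C => by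
    rw [mem_famMap, Equiv.sumComm_symm, map_sumComm_disjSum]
  rw [refl_famMap]
  unfold sgnDiff
  simp only [key]

/-- The column half is the row half of the block-swapped data. [this work] -/
theorem rectCol_eq_rectRow_swap (P₁ : Finset (Finset γ₁)) (Q : Finset (Finset γ₂)) (A₁ : Finset (Finset γ₁)) (A₂ : Finset (Finset γ₂))
    (B : Finset (Finset (γ₁ ⊕ γ₂))) :
    ∑ y ∈ Q, sgnDiff A₂ (refl A₂) y * ∑ x ∈ P₁, (ind A₁ x + ind A₁ xᶜ) * sgnDiff B (refl B) (x.disjSum y)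
      = ∑ y ∈ Q, sgnDiff A₂ (refl A₂) y *
          ∑ x ∈ P₁, (ind A₁ x + ind A₁ xᶜ) * sgnDiff (famMap (Equiv.sumComm γ₁ γ₂) B) (refl (famMap (Equiv.sumComm γ₁ γ₂) B)) (y.disjSum x) := by
  refine sum_congr rfl fun y _ => ?_
  congr 1
  exact sum_congr rfl fun x _ => by rw [sgnDiff_famMap_sumComm]

/-! ### The theorems -/

/-- **THEOREM (rectangle tests with good sides).**  Let `P₁ ⊆ 2^{γ₁}` and `Q ⊆ 2^{γ₂}` be antipode-free up-sets with `Cor ≥ 0` on all pairs of up-sets,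
`A₁ ⊆ 2^{γ₁}` and `A₂ ⊆ 2^{γ₂}` up-sets with `Cor_{A₁} ≥ 0` and `Cor_{A₂} ≥ 0` on all pairs of up-sets, and `B` any up-set of the product cube.
Then `Cor_{P₁ ∧ Q}(A₁ × A₂, B) ≥ 0`. [this work] -/
theorem corP_andProd_rect_nonneg {P₁ : Finset (Finset γ₁)} (hP : IsUpperSet (P₁ : Set (Finset γ₁))) (hd : Disjoint P₁ (refl P₁))
    (hcor : ∀ U V : Finset (Finset γ₁), IsUpperSet (U : Set (Finset γ₁)) → IsUpperSet (V : Set (Finset γ₁)) → 0 ≤ corP P₁ U V)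
    {Q : Finset (Finset γ₂)} (hQ : IsUpperSet (Q : Set (Finset γ₂))) (hdQ : Disjoint Q (refl Q))
    (hcorQ : ∀ U V : Finset (Finset γ₂), IsUpperSet (U : Set (Finset γ₂)) → IsUpperSet (V : Set (Finset γ₂)) → 0 ≤ corP Q U V)
    {A₁ : Finset (Finset γ₁)} (hA₁ : IsUpperSet (A₁ : Set (Finset γ₁)))
    (hcor₁ : ∀ U V : Finset (Finset γ₁), IsUpperSet (U : Set (Finset γ₁)) → IsUpperSet (V : Set (Finset γ₁)) → 0 ≤ corP A₁ U V)
    {A₂ : Finset (Finset γ₂)} (hA₂ : IsUpperSet (A₂ : Set (Finset γ₂)))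
    (hcor₂ : ∀ U V : Finset (Finset γ₂), IsUpperSet (U : Set (Finset γ₂)) → IsUpperSet (V : Set (Finset γ₂)) → 0 ≤ corP A₂ U V)
    {B : Finset (Finset (γ₁ ⊕ γ₂))} (hB : IsUpperSet (B : Set (Finset (γ₁ ⊕ γ₂)))) :
    0 ≤ corP (andProd P₁ Q) (andProd A₁ A₂) B := by
  have hrow := rectRow_nonneg hP hd hcor hA₁ hcor₂ hQ hB
  have hcol : 0 ≤ ∑ y ∈ Q, sgnDiff A₂ (refl A₂) y * ∑ x ∈ P₁, (ind A₁ x + ind A₁ xᶜ) * sgnDiff B (refl B) (x.disjSum y) := by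
    rw [rectCol_eq_rectRow_swap]
    exact rectRow_nonneg hQ hdQ hcorQ hA₂ hcor₁ hP (isUpperSet_famMap _ hB)
  have h2 := two_mul_corP_andProd_rect_eq P₁ Q A₁ A₂ B
  linarith

/-- The same with the rectangle in the second slot. [this work] -/
theorem corP_andProd_rect_nonneg_right {P₁ : Finset (Finset γ₁)} (hP : IsUpperSet (P₁ : Set (Finset γ₁))) (hd : Disjoint P₁ (refl P₁))
    (hcor : ∀ U V : Finset (Finset γ₁), IsUpperSet (U : Set (Finset γ₁)) → IsUpperSet (V : Set (Finset γ₁)) → 0 ≤ corP P₁ U V)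
    {Q : Finset (Finset γ₂)} (hQ : IsUpperSet (Q : Set (Finset γ₂))) (hdQ : Disjoint Q (refl Q))
    (hcorQ : ∀ U V : Finset (Finset γ₂), IsUpperSet (U : Set (Finset γ₂)) → IsUpperSet (V : Set (Finset γ₂)) → 0 ≤ corP Q U V)
    {A₁ : Finset (Finset γ₁)} (hA₁ : IsUpperSet (A₁ : Set (Finset γ₁)))
    (hcor₁ : ∀ U V : Finset (Finset γ₁), IsUpperSet (U : Set (Finset γ₁)) → IsUpperSet (V : Set (Finset γ₁)) → 0 ≤ corP A₁ U V)
    {A₂ : Finset (Finset γ₂)} (hA₂ : IsUpperSet (A₂ : Set (Finset γ₂)))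
    (hcor₂ : ∀ U V : Finset (Finset γ₂), IsUpperSet (U : Set (Finset γ₂)) → IsUpperSet (V : Set (Finset γ₂)) → 0 ≤ corP A₂ U V)
    {B : Finset (Finset (γ₁ ⊕ γ₂))} (hB : IsUpperSet (B : Set (Finset (γ₁ ⊕ γ₂)))) :
    0 ≤ corP (andProd P₁ Q) B (andProd A₁ A₂) := by
  rw [corP_comm]
  exact corP_andProd_rect_nonneg hP hd hcor hQ hdQ hcorQ hA₁ hcor₁ hA₂ hcor₂ hB

/-- The same with all four hypotheses in Kleitman-shell form (antipode-free sides). [this work] -/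
theorem corP_andProd_rect_nonneg_of_klShell {P₁ : Finset (Finset γ₁)} (hP : IsUpperSet (P₁ : Set (Finset γ₁))) (hd : Disjoint P₁ (refl P₁))
    (hs : KlShell (P₁ ∪ refl P₁))
    {Q : Finset (Finset γ₂)} (hQ : IsUpperSet (Q : Set (Finset γ₂))) (hdQ : Disjoint Q (refl Q)) (hsQ : KlShell (Q ∪ refl Q))
    {A₁ : Finset (Finset γ₁)} (hA₁ : IsUpperSet (A₁ : Set (Finset γ₁))) (hdA₁ : Disjoint A₁ (refl A₁)) (hsA₁ : KlShell (A₁ ∪ refl A₁))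
    {A₂ : Finset (Finset γ₂)} (hA₂ : IsUpperSet (A₂ : Set (Finset γ₂))) (hdA₂ : Disjoint A₂ (refl A₂)) (hsA₂ : KlShell (A₂ ∪ refl A₂))
    {B : Finset (Finset (γ₁ ⊕ γ₂))} (hB : IsUpperSet (B : Set (Finset (γ₁ ⊕ γ₂)))) :
    0 ≤ corP (andProd P₁ Q) (andProd A₁ A₂) B :=
  corP_andProd_rect_nonneg hP hd (fun U V hU hV => by rw [corP_eq_card_sub_card_of_disjoint hd]; exact hs U V hU hV) hQ hdQ
    (fun U V hU hV => by rw [corP_eq_card_sub_card_of_disjoint hdQ]; exact hsQ U V hU hV) hA₁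
    (fun U V hU hV => by rw [corP_eq_card_sub_card_of_disjoint hdA₁]; exact hsA₁ U V hU hV) hA₂
    (fun U V hU hV => by rw [corP_eq_card_sub_card_of_disjoint hdA₂]; exact hsA₂ U V hU hV) hB

/-! ### Admissible sides -/

/-- **The one-block theorem as the rectangle `A₁ × univ`** (sanity link with `…TriWAndOneBlock`; here `A₁` must itself have `Cor ≥ 0`). [this work] -/
theorem corP_andProd_rect_univ_nonneg {P₁ : Finset (Finset γ₁)} (hP : IsUpperSet (P₁ : Set (Finset γ₁))) (hd : Disjoint P₁ (refl P₁))
    (hcor : ∀ U V : Finset (Finset γ₁), IsUpperSet (U : Set (Finset γ₁)) → IsUpperSet (V : Set (Finset γ₁)) → 0 ≤ corP P₁ U V)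
    {Q : Finset (Finset γ₂)} (hQ : IsUpperSet (Q : Set (Finset γ₂))) (hdQ : Disjoint Q (refl Q))
    (hcorQ : ∀ U V : Finset (Finset γ₂), IsUpperSet (U : Set (Finset γ₂)) → IsUpperSet (V : Set (Finset γ₂)) → 0 ≤ corP Q U V)
    {A₁ : Finset (Finset γ₁)} (hA₁ : IsUpperSet (A₁ : Set (Finset γ₁)))
    (hcor₁ : ∀ U V : Finset (Finset γ₁), IsUpperSet (U : Set (Finset γ₁)) → IsUpperSet (V : Set (Finset γ₁)) → 0 ≤ corP A₁ U V)
    {B : Finset (Finset (γ₁ ⊕ γ₂))} (hB : IsUpperSet (B : Set (Finset (γ₁ ⊕ γ₂)))) :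
    0 ≤ corP (andProd P₁ Q) (andProd A₁ univ) B :=
  corP_andProd_rect_nonneg hP hd hcor hQ hdQ hcorQ hA₁ hcor₁ (by rw [coe_univ]; exact isUpperSet_univ)
    (fun U V hU hV => corP_univ_nonneg hU hV) hB

/-- **Self-dual sides**: for self-dual `A₁, A₂` (e.g. dictators, `maj`, `perfect4`, …) and good `P₁, Q`, the rectangle test `A₁ × A₂` passes
for every `B`. [this work] -/
theorem corP_andProd_rect_selfDual_nonneg {P₁ : Finset (Finset γ₁)} (hP : IsUpperSet (P₁ : Set (Finset γ₁))) (hd : Disjoint P₁ (refl P₁))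
    (hcor : ∀ U V : Finset (Finset γ₁), IsUpperSet (U : Set (Finset γ₁)) → IsUpperSet (V : Set (Finset γ₁)) → 0 ≤ corP P₁ U V)
    {Q : Finset (Finset γ₂)} (hQ : IsUpperSet (Q : Set (Finset γ₂))) (hdQ : Disjoint Q (refl Q))
    (hcorQ : ∀ U V : Finset (Finset γ₂), IsUpperSet (U : Set (Finset γ₂)) → IsUpperSet (V : Set (Finset γ₂)) → 0 ≤ corP Q U V)
    {A₁ : Finset (Finset γ₁)} (hA₁ : IsUpperSet (A₁ : Set (Finset γ₁))) (hsd₁ : ∀ u : Finset γ₁, uᶜ ∈ A₁ ↔ u ∉ A₁)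
    {A₂ : Finset (Finset γ₂)} (hA₂ : IsUpperSet (A₂ : Set (Finset γ₂))) (hsd₂ : ∀ u : Finset γ₂, uᶜ ∈ A₂ ↔ u ∉ A₂)
    {B : Finset (Finset (γ₁ ⊕ γ₂))} (hB : IsUpperSet (B : Set (Finset (γ₁ ⊕ γ₂)))) :
    0 ≤ corP (andProd P₁ Q) (andProd A₁ A₂) B :=
  corP_andProd_rect_nonneg hP hd hcor hQ hdQ hcorQ hA₁ (fun _ _ hU hV => corP_nonneg_of_selfDual hsd₁ hU hV) hA₂
    (fun _ _ hU hV => corP_nonneg_of_selfDual hsd₂ hU hV) hB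

end FiveUpSet

end Summit.CriticalPhenomena.PercolationContinuityZ3.Theorems
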